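import Mathlib.RingTheory.MvPolynomial.WeightedHomogeneous
import Mathlib.RingTheory.Ideal.IsPrimary
import Literature.Computability.AlgebraicComplexity.LS00TwoByTwoPermanentalIdealsRadical
import HarnessLib

/-!
# Laubenbacher–Swanson 2000, Theorem 5.7: the primary decomposition `P₂(M) = Q ∩ I₁ ∩ I₂ ∩ I₃`

Topic `Literature/Computability/AlgebraicComplexity`; theorem-only file (no definitions, no named
facts), fourth sibling of the `LS00TwoByTwoPermanentalIdeals*` files (Lemma 2.1 / Thm. 4.1 /
heights; minimal primes / Rem. 4.2 / Cor. 4.3; Lemma 2.2 / §5 radical / Prop. 5.1).  Source: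
R. C. Laubenbacher, I. Swanson, *Permanental ideals*, J. Symbolic Comput. 30 (2000) 195–205,
arXiv:math/9812112 (held; unnumbered heads in the arXiv text — Theorem 5.7 = p0008 L98–108, its
lead-in `Q := P₂ + ⟨x_{ij}²⟩` and the displayed modular-law identity p0008 L48–96).  `F` a field
with `2 ≠ 0` (the paper: characteristic `≠ 2`) for the theorem; the component lemmas hold over a
commutative ring with `2` a unit; `P₂(M) = BoraleviCarliniMichalekVentura2025.subpermIdeal F m n 2`.
This is the paper's "principal result" (abstract: "a primary decomposition of ideals generated by
the `2 × 2`-subpermanents of a generic matrix").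

## What is typed

* `thm_5_7` — **Theorem 5.7, the displayed identity** ("Let `m, n ≥ 3`.  The intersection
  `P₂(M) = Q ∩ I₁ ∩ I₂ ∩ I₃` … is an irredundant primary decomposition of `P₂(M)`", with
  `Q = P₂(M) + ⟨x_{ij}² | 1 ≤ i ≤ m, 1 ≤ j ≤ n⟩`): for `m, n ≥ 3` over a field with `2 ≠ 0`,
  `P₂(M) = (P₂(M) + ⟨x_{ij}²⟩) ∩ (I₁ ∩ I₂ ∩ I₃)` with `I₁, I₂, I₃` the infima of the type (1), (2),
  (3) ideals of Thm. 4.1 exactly as in `LaubenbacherSwanson2000.radical_eq_inf` (whose statement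
  `rad P₂(M) = I₁ ∩ I₂ ∩ I₃` is consumed by name); `thm_5_7_radical` — the same as
  `P₂(M) = Q ∩ rad P₂(M)`, typed for all `m, n ≥ 2`.
* `isPrimary_sup_span_sq`, `radical_sup_span_sq`, `isMaximal_radical_sup_span_sq` — "`Q` is primary to
  the homogeneous maximal ideal of all variables" (p0008 L93): `Q` is a primary ideal whose radical
  is the (maximal) ideal of all the variables; with the primality of the type ideals
  (`isPrime_span_X_image`, `isPrime_blockIdeal`) the identity is therefore a primary decomposition
  of `P₂(M)` with the embedded component `Q` made explicit.
* `span_sq_inf_sup_span_triple_le` — the key inclusion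
  `⟨x_{ij}²⟩ ∩ (P₂(M) + ⟨x_{ip}x_{jq}x_{kr} | i,j,k distinct, p,q,r distinct⟩) ⊆ P₂(M)` (p0008
  L62–76), `2` a unit, any `m, n`.

## Proof deviation (statements as printed)

The paper proves the key inclusion with its §3 Gröbner basis ("we use Gröbner bases again, in any
diagonal term order … least common multiples of these two types of monomials are all in the ideal
generated by monomials of types (2)–(6)", p0008 L71–91).  Here, Gröbner-free: grade
`F[x_{ij}]` by the ROW/COLUMN CONTENT `x_{ij} ↦ (e_i, e_j) ∈ ℕ^m × ℕ^n` (Mathlib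
`weightedHomogeneousComponent` for this weight — the squarefree-multidegree projector) and observe
(i) `P₂(M)` is bihomogeneous (`weightedHomogeneousComponent_mem_subpermIdeal`: the two monomials of
`u · per[ab|cd]` have the same content); (ii) an element of `⟨x_{ij}²⟩` has no component in a
content with all entries `≤ 1` (`weightedHomogeneousComponent_eq_zero_of_mem_span_sq`); (iii) a
multiple `u · x_{ip}x_{jq}x_{kr}` of a permutation triple whose content has an entry `≥ 2` lies in
`P₂(M)` by Lemmas 2.1–2.2 (`monomial_mem_of_triple_of_two_le_weight`, a case tree: a squared
variable, or two variables in one row / one column, against the triple); hence every component of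
`f = p + t ∈ ⟨x_{ij}²⟩ ∩ (P₂ + T)` lies in `P₂(M)`.  The modular-law step
`(P₂ + ⟨x_{ij}²⟩) ∩ (P₂ + T) = P₂ + ⟨x_{ij}²⟩ ∩ (P₂ + T)` is the printed one (p0008 L58–64).

## What is NOT typed

* The word "irredundant" of Theorem 5.7 (no component can be omitted and the associated primes are
  distinct) — it needs the associated-prime bookkeeping of the components of heights `(m−1)n`,
  `m(n−1)`, `mn − 3` and `mn`; Corollary 5.6 ("embedded components iff `m, n ≥ 3`") likewise;
  Corollary 5.5 (regularity); §3.

Honest framing: V0 dictionary (commutative algebra of `P₂(M)`); no rung of any route moves; VP ≠ VNP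
is NOT proved.

## References

* R. C. Laubenbacher, I. Swanson, *Permanental ideals*, J. Symbolic Comput. 30 (2000) 195–205,
  arXiv:math/9812112: Thm. 5.7 (p0008 L98–108), its proof (p0008 L48–96), Lemmas 2.1–2.2 (p0003
  L10–65). [LaubenbacherSwanson2000]
* A. Boralevi, E. Carlini, M. Michałek, E. Ventura, *On the codimension of permanental
  varieties*, Adv. Math. 461 (2025), arXiv:2402.17839 (`subpermIdeal`).
  [BoraleviCarliniMichalekVentura2025]
-/

noncomputable section

open Matrix MvPolynomial Finset

namespace Literature.Computability.AlgebraicComplexity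

namespace LaubenbacherSwanson2000

open VonZurGathen BoraleviCarliniMichalekVentura2025

/-! ### §0. Private plumbing (copies of private helpers of the sibling file) -/

section Plumbing

variable {F : Type*} [CommRing F] {σ : Type*}

/-- `x_a x_b x_c ∣ x^u` iff `a, b, c ∈ supp u` (`a, b, c` pairwise distinct). [folklore] -/
private theorem single_add_single_add_single_le_iff {a b c : σ} (hab : a ≠ b) (hac : a ≠ c)
    (hbc : b ≠ c) (u : σ →₀ ℕ) :
    Finsupp.single a 1 + Finsupp.single b 1 + Finsupp.single c 1 ≤ u ↔
      u a ≠ 0 ∧ u b ≠ 0 ∧ u c ≠ 0 := by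
  classical
  constructor
  · intro h
    have ha := h a
    have hb := h b
    have hc := h c
    rw [Finsupp.add_apply, Finsupp.add_apply, Finsupp.single_eq_same,
      Finsupp.single_eq_of_ne hab, Finsupp.single_eq_of_ne hac] at ha
    rw [Finsupp.add_apply, Finsupp.add_apply, Finsupp.single_eq_of_ne hab.symm,
      Finsupp.single_eq_same, Finsupp.single_eq_of_ne hbc] at hb
    rw [Finsupp.add_apply, Finsupp.add_apply, Finsupp.single_eq_of_ne hac.symm,
      Finsupp.single_eq_of_ne hbc.symm, Finsupp.single_eq_same] at hc
    omega
  · rintro ⟨ha, hb, hc⟩ x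
    simp only [Finsupp.add_apply, Finsupp.single_apply]
    by_cases hxa : a = x
    · rw [if_pos hxa, if_neg (fun h => hab (hxa.trans h.symm)),
        if_neg (fun h => hac (hxa.trans h.symm)), ← hxa]
      omega
    by_cases hxb : b = x
    · rw [if_neg hxa, if_pos hxb, if_neg (fun h => hbc (hxb.trans h.symm)), ← hxb]
      omega
    by_cases hxc : c = x
    · rw [if_neg hxa, if_neg hxb, if_pos hxc, ← hxc]
      omega
    · rw [if_neg hxa, if_neg hxb, if_neg hxc]
      omega

/-- If three distinct points `a, b, c` of the support of `u` have `x_a x_b x_c ∈ I`, then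
`x^u ∈ I`. [folklore] -/
private theorem monomial_mem_of_triple_mem {I : Ideal (MvPolynomial σ F)} {u : σ →₀ ℕ}
    {a b c : σ} (hab : a ≠ b) (hac : a ≠ c) (hbc : b ≠ c) (ha : u a ≠ 0) (hb : u b ≠ 0)
    (hc : u c ≠ 0) (h : (X a * X b * X c : MvPolynomial σ F) ∈ I) :
    monomial u (1 : F) ∈ I := by
  have hle : Finsupp.single a 1 + Finsupp.single b 1 + Finsupp.single c 1 ≤ u :=
    (single_add_single_add_single_le_iff hab hac hbc u).2 ⟨ha, hb, hc⟩
  obtain ⟨w, hw⟩ := exists_add_of_le hle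
  have e : (monomial u (1 : F) : MvPolynomial σ F) = monomial w 1 * (X a * X b * X c) := by
    rw [hw, add_comm]
    simp [X, monomial_mul]
  rw [e]
  exact Ideal.mul_mem_left _ _ h


end Plumbing

section PlumbingRing

variable {R : Type*} [CommRing R]

/-- `P₂(M) ≤ J` as soon as `J` contains every written-out `2 × 2` permanent (the generators), over
a commutative ring (the sibling file's `subpermIdeal_two_le_of_pairs` is stated for fields).
[cite: LaubenbacherSwanson2000, §1 (definition of `P_r(M)`, arXiv text p0002 L36–41)] -/
private theorem subpermIdeal_two_le_of_pairs' {m n : ℕ} (J : Ideal (MvPolynomial (Fin m × Fin n) R))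
    (h : ∀ (r s : Fin m) (i j : Fin n), r ≠ s → i ≠ j →
      (X (r, i) * X (s, j) + X (r, j) * X (s, i) : MvPolynomial (Fin m × Fin n) R) ∈ J) :
    subpermIdeal R m n 2 ≤ J := by
  classical
  refine subpermIdeal_le_iff.2 fun Rw Cl hR hC => ?_
  obtain ⟨r, s, hrs, rfl⟩ := Finset.card_eq_two.1 hR
  obtain ⟨i, j, hij, rfl⟩ := Finset.card_eq_two.1 hC
  rw [rsubperm_pair _ hrs hij]
  simpa only [Matrix.mvPolynomialX_apply] using h r s i j hrs hij


end PlumbingRing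

section Theorem57

variable {F : Type*} [CommRing F] {m n : ℕ}

/-! ### §A. Row/column content and its homogeneous components

The weight `x_{ij} ↦ (e_i, e_j) ∈ ℕ^m × ℕ^n` (row content, column content); its weighted
homogeneous components (Mathlib `weightedHomogeneousComponent`) replace the paper's second appeal to
the §3 Gröbner basis (proof deviation, statements as printed). -/

/-- The two monomials of `u · per[ab|cd]` have the same row/column content. [folklore] -/
private theorem weight_perPair_eq (u : Fin m × Fin n →₀ ℕ) (a b : Fin m) (c d : Fin n) :
    Finsupp.weight (fun x : Fin m × Fin n => (Finsupp.single x.1 (1 : ℕ), Finsupp.single x.2 (1 : ℕ)))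
        (u + Finsupp.single (a, c) 1 + Finsupp.single (b, d) 1) =
      Finsupp.weight (fun x : Fin m × Fin n => (Finsupp.single x.1 (1 : ℕ), Finsupp.single x.2 (1 : ℕ)))
        (u + Finsupp.single (a, d) 1 + Finsupp.single (b, c) 1) := by
  simp only [map_add, Finsupp.weight_single, one_smul]
  refine Prod.ext ?_ ?_
  · simp only [Prod.fst_add]
  · simp only [Prod.snd_add]
    abel

/-- A weighted homogeneous component of a monomial is the monomial or `0`. [folklore] -/
private theorem whc_monomial {M : Type*} [AddCommMonoid M] [DecidableEq M] (w : Fin m × Fin n → M)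
    (δ : M) (d : Fin m × Fin n →₀ ℕ) (c : F) :
    weightedHomogeneousComponent w δ (monomial d c) =
      if Finsupp.weight w d = δ then monomial d c else 0 := by
  classical
  ext u
  simp only [coeff_weightedHomogeneousComponent, apply_ite (coeff u), coeff_monomial, coeff_zero]
  by_cases hdu : d = u
  · subst hdu
    rfl
  · simp [hdu]

/-- **`P₂(M)` is bihomogeneous for the row/column content**: every weighted homogeneous component
of an element of `P₂(M)` lies in `P₂(M)` (the generators `x_{ac}x_{bd} + x_{ad}x_{bc}` are
bihomogeneous).  Proof deviation replacing LS's Gröbner normal forms (p0008 L71–91).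
[cite: LaubenbacherSwanson2000, proof of Thm. 5.7 (arXiv text p0008 L54–96)] -/
theorem weightedHomogeneousComponent_mem_subpermIdeal {p : MvPolynomial (Fin m × Fin n) F}
    (hp : p ∈ subpermIdeal F m n 2) (δ : (Fin m →₀ ℕ) × (Fin n →₀ ℕ)) :
    weightedHomogeneousComponent
        (fun x : Fin m × Fin n => (Finsupp.single x.1 (1 : ℕ), Finsupp.single x.2 (1 : ℕ))) δ p ∈
      subpermIdeal F m n 2 := by
  classical
  suffices H : ∀ f ∈ subpermIdeal F m n 2, ∀ g : MvPolynomial (Fin m × Fin n) F,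
      weightedHomogeneousComponent
        (fun x : Fin m × Fin n => (Finsupp.single x.1 (1 : ℕ), Finsupp.single x.2 (1 : ℕ))) δ
          (g * f) ∈ subpermIdeal F m n 2 by
    simpa only [one_mul] using H p hp 1
  intro f hf
  refine Submodule.span_induction ?_ ?_ ?_ ?_ hf
  · rintro f ⟨Rw, Cl, hR, hC, rfl⟩ g
    obtain ⟨a, b, hab, rfl⟩ := Finset.card_eq_two.1 hR
    obtain ⟨c, d, hcd, rfl⟩ := Finset.card_eq_two.1 hC
    rw [rsubperm_pair _ hab hcd]
    simp only [Matrix.mvPolynomialX_apply]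
    induction g using MvPolynomial.induction_on' with
    | monomial u k =>
      have e : (monomial u k * (X (a, c) * X (b, d) + X (a, d) * X (b, c)) :
          MvPolynomial (Fin m × Fin n) F) =
          monomial (u + Finsupp.single (a, c) 1 + Finsupp.single (b, d) 1) k +
            monomial (u + Finsupp.single (a, d) 1 + Finsupp.single (b, c) 1) k := by
        simp only [X, monomial_mul, mul_add, mul_one, add_assoc]
      rw [e, map_add, whc_monomial, whc_monomial, ← weight_perPair_eq u a b c d]
      by_cases h : Finsupp.weight
          (fun x : Fin m × Fin n => (Finsupp.single x.1 (1 : ℕ), Finsupp.single x.2 (1 : ℕ)))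
          (u + Finsupp.single (a, c) 1 + Finsupp.single (b, d) 1) = δ
      · rw [if_pos h, if_pos h, ← e]
        exact Ideal.mul_mem_left _ _ (pair_mem_subpermIdeal_two F hab hcd)
      · rw [if_neg h, if_neg h, add_zero]
        exact Ideal.zero_mem _
    | add p q hp hq =>
      rw [add_mul, map_add]
      exact Ideal.add_mem _ hp hq
  · intro g
    simp
  · intro x y _ _ hx hy g
    rw [mul_add, map_add]
    exact Ideal.add_mem _ (hx g) (hy g)
  · intro r x _ hx g
    rw [smul_eq_mul, ← mul_assoc]
    exact hx (g * r)

/-- The row content of `x^u` at row `i` is the sum of the exponents in row `i`. [folklore] -/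
private theorem weight_fst_apply (u : Fin m × Fin n →₀ ℕ) (i : Fin m) :
    (Finsupp.weight (fun x : Fin m × Fin n => (Finsupp.single x.1 (1 : ℕ), Finsupp.single x.2 (1 : ℕ)))
        u).1 i = ∑ x ∈ u.support with x.1 = i, u x := by
  classical
  rw [Finsupp.weight_apply, Finsupp.sum, Prod.fst_sum, Finsupp.finsetSum_apply, Finset.sum_filter]
  refine Finset.sum_congr rfl fun x _ => ?_
  simp only [Prod.smul_fst, Finsupp.smul_apply, Finsupp.single_apply, smul_eq_mul, mul_ite,
    mul_one, mul_zero]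

/-- The column content of `x^u` at column `j`. [folklore] -/
private theorem weight_snd_apply (u : Fin m × Fin n →₀ ℕ) (j : Fin n) :
    (Finsupp.weight (fun x : Fin m × Fin n => (Finsupp.single x.1 (1 : ℕ), Finsupp.single x.2 (1 : ℕ)))
        u).2 j = ∑ x ∈ u.support with x.2 = j, u x := by
  classical
  rw [Finsupp.weight_apply, Finsupp.sum, Prod.snd_sum, Finsupp.finsetSum_apply, Finset.sum_filter]
  refine Finset.sum_congr rfl fun x _ => ?_
  simp only [Prod.smul_snd, Finsupp.smul_apply, Finsupp.single_apply, smul_eq_mul, mul_ite,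
    mul_one, mul_zero]

/-- A sum of naturals `≥ 2` has a term `≥ 2` or two distinct nonzero terms. [folklore] -/
private theorem exists_of_two_le_sum {α : Type*} {S : Finset α} {g : α → ℕ}
    (h : 2 ≤ ∑ x ∈ S, g x) :
    (∃ x ∈ S, 2 ≤ g x) ∨ ∃ x ∈ S, ∃ y ∈ S, x ≠ y ∧ g x ≠ 0 ∧ g y ≠ 0 := by
  classical
  by_cases h1 : ∃ x ∈ S, 2 ≤ g x
  · exact Or.inl h1
  right
  have hle : ∀ x ∈ S, g x ≤ 1 := fun x hx => by
    by_contra h'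
    exact h1 ⟨x, hx, by omega⟩
  have hsum : ∑ x ∈ S, g x ≤ (S.filter fun x => g x ≠ 0).card := by
    rw [← Finset.sum_filter_ne_zero]
    calc ∑ x ∈ S.filter (fun x => g x ≠ 0), g x
        ≤ ∑ x ∈ S.filter (fun x => g x ≠ 0), 1 :=
          Finset.sum_le_sum fun x hx => hle x (Finset.mem_filter.1 hx).1
      _ = (S.filter fun x => g x ≠ 0).card := by simp
  obtain ⟨x, hx, y, hy, hxy⟩ :=
    Finset.one_lt_card.1 (show 1 < (S.filter fun x => g x ≠ 0).card by omega)
  exact ⟨x, (Finset.mem_filter.1 hx).1, y, (Finset.mem_filter.1 hy).1, hxy,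
    (Finset.mem_filter.1 hx).2, (Finset.mem_filter.1 hy).2⟩

/-! ### §B. Multiples of a permutation triple outside the partial permutations lie in `P₂(M)` -/

/-- `x^v ∈ I` as soon as `x^s ∈ I` for some `s ≤ v`. [folklore] -/
private theorem monomial_mem_of_le {σ : Type*} {I : Ideal (MvPolynomial σ F)} {s v : σ →₀ ℕ}
    (hs : s ≤ v) (h : (monomial s (1 : F) : MvPolynomial σ F) ∈ I) : monomial v (1 : F) ∈ I := by
  obtain ⟨w, rfl⟩ := exists_add_of_le hs
  have e : (monomial (s + w) (1 : F) : MvPolynomial σ F) = monomial s 1 * monomial w 1 := by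
    rw [monomial_mul, mul_one]
  rw [e]
  exact Ideal.mul_mem_right _ _ h

/-- `x_p x_q x_x² ∣ x^u` when `p, q, x` are distinct, `p, q ∈ supp u` and `u x ≥ 2`. [folklore] -/
private theorem single_add_single_add_two_le {σ : Type*} {p q x : σ} (hpq : p ≠ q) (hpx : p ≠ x)
    (hqx : q ≠ x) (u : σ →₀ ℕ) (hp : u p ≠ 0) (hq : u q ≠ 0) (hx : 2 ≤ u x) :
    Finsupp.single p 1 + Finsupp.single q 1 + (Finsupp.single x 1 + Finsupp.single x 1) ≤ u := by
  classical
  intro y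
  simp only [Finsupp.add_apply, Finsupp.single_apply]
  by_cases hyp : p = y
  · rw [if_pos hyp, if_neg (fun h => hpq (hyp.trans h.symm)), if_neg (fun h => hpx (hyp.trans h.symm)),
      ← hyp]
    omega
  by_cases hyq : q = y
  · rw [if_neg hyp, if_pos hyq, if_neg (fun h => hqx (hyq.trans h.symm)), ← hyq]
    omega
  by_cases hyx : x = y
  · rw [if_neg hyp, if_neg hyq, if_pos hyx, ← hyx]
    omega
  · rw [if_neg hyp, if_neg hyq, if_neg hyx]
    omega

/-- **Row sharing**: if a support point `x ≠ a` of `u` lies in the row of `a`, where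
`a, b, c ∈ supp u` form a permutation triple, then `x^u ∈ P₂(M)` (Lemma 2.1, two rows and three
columns: `x_a x_x x_{t}` with `t ∈ {b, c}` off the column of `x`). [cite: LaubenbacherSwanson2000, Lemma 2.1 (arXiv text p0003 L10–35)] -/
private theorem monomial_mem_of_rowShare (h2 : IsUnit (2 : F)) {u : Fin m × Fin n →₀ ℕ}
    {a b c x : Fin m × Fin n} (hab1 : a.1 ≠ b.1) (hac1 : a.1 ≠ c.1) (hbc2 : b.2 ≠ c.2)
    (hab2 : a.2 ≠ b.2) (hac2 : a.2 ≠ c.2)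
    (ha : u a ≠ 0) (hb : u b ≠ 0) (hc : u c ≠ 0) (hx : u x ≠ 0) (hxa : x.1 = a.1)
    (hxne : x ≠ a) : (monomial u (1 : F) : MvPolynomial (Fin m × Fin n) F) ∈ subpermIdeal F m n 2 := by
  obtain ⟨i, p⟩ := a
  obtain ⟨j, q⟩ := b
  obtain ⟨k, r⟩ := c
  obtain ⟨x1, x2⟩ := x
  simp only at hab1 hac1 hbc2 hab2 hac2 hxa
  subst hxa
  have hx2 : x2 ≠ p := fun h => hxne (by rw [h])
  by_cases hxq : x2 = q
  · -- use `c`: columns `p, x2 = q, r` pairwise distinct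
    subst hxq
    have hmem := lemma_2_1_rows h2 hac1 hx2.symm hac2 hbc2 (F := F)
    -- `x_{i p} x_{i x2} x_{k r}` (the row `i` is now called `x1`)
    exact monomial_mem_of_triple_mem (a := (x1, p)) (b := (x1, x2)) (c := (k, r))
      (fun h => hx2 (Prod.mk.inj h).2.symm) (fun h => hac1 (Prod.mk.inj h).1)
      (fun h => hac1 (Prod.mk.inj h).1) ha hx hc hmem
  · have hmem := lemma_2_1_rows h2 hab1 hx2.symm hab2 hxq (F := F)
    exact monomial_mem_of_triple_mem (a := (x1, p)) (b := (x1, x2)) (c := (j, q))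
      (fun h => hx2 (Prod.mk.inj h).2.symm) (fun h => hab1 (Prod.mk.inj h).1)
      (fun h => hab1 (Prod.mk.inj h).1) ha hx hb hmem

/-- **Column sharing**: the transposed statement. [cite: LaubenbacherSwanson2000, Lemma 2.1 (arXiv text p0003 L10–35)] -/
private theorem monomial_mem_of_colShare (h2 : IsUnit (2 : F)) {u : Fin m × Fin n →₀ ℕ}
    {a b c x : Fin m × Fin n} (hab2 : a.2 ≠ b.2) (hac2 : a.2 ≠ c.2) (hbc1 : b.1 ≠ c.1)
    (hab1 : a.1 ≠ b.1) (hac1 : a.1 ≠ c.1)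
    (ha : u a ≠ 0) (hb : u b ≠ 0) (hc : u c ≠ 0) (hx : u x ≠ 0) (hxa : x.2 = a.2)
    (hxne : x ≠ a) : (monomial u (1 : F) : MvPolynomial (Fin m × Fin n) F) ∈ subpermIdeal F m n 2 := by
  obtain ⟨i, p⟩ := a
  obtain ⟨j, q⟩ := b
  obtain ⟨k, r⟩ := c
  obtain ⟨x1, x2⟩ := x
  simp only at hab1 hac1 hbc1 hab2 hac2 hxa
  subst hxa
  have hx1 : x1 ≠ i := fun h => hxne (by rw [h])
  by_cases hxj : x1 = j
  · subst hxj
    have hmem := lemma_2_1_cols h2 hx1.symm hac1 hbc1 hac2 (F := F)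
    -- `x_{i p} x_{x1 p} x_{k r}` (the column `p` is now called `x2`)
    exact monomial_mem_of_triple_mem (a := (i, x2)) (b := (x1, x2)) (c := (k, r))
      (fun h => hx1 (Prod.mk.inj h).1.symm) (fun h => hac1 (Prod.mk.inj h).1)
      (fun h => hbc1 (Prod.mk.inj h).1) ha hx hc hmem
  · have hmem := lemma_2_1_cols h2 hx1.symm hab1 hxj hab2 (F := F)
    exact monomial_mem_of_triple_mem (a := (i, x2)) (b := (x1, x2)) (c := (j, q))
      (fun h => hx1 (Prod.mk.inj h).1.symm) (fun h => hab1 (Prod.mk.inj h).1)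
      (fun h => hxj (Prod.mk.inj h).1) ha hx hb hmem

/-- **A squared variable**: if `u x ≥ 2` for some `x`, and `a, b, c ∈ supp u` form a permutation
triple, then `x^u ∈ P₂(M)` (Lemma 2.2 when `x` is one of `a, b, c` or avoids their rows and
columns; Lemma 2.1 when `x` shares a row or a column with one of them). [cite: LaubenbacherSwanson2000, Lemmas 2.1–2.2 (arXiv text p0003 L10–65)] -/
private theorem monomial_mem_of_sq (h2 : IsUnit (2 : F)) {u : Fin m × Fin n →₀ ℕ}
    {a b c x : Fin m × Fin n} (hab1 : a.1 ≠ b.1) (hac1 : a.1 ≠ c.1) (hbc1 : b.1 ≠ c.1)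
    (hab2 : a.2 ≠ b.2) (hac2 : a.2 ≠ c.2) (hbc2 : b.2 ≠ c.2)
    (ha : u a ≠ 0) (hb : u b ≠ 0) (hc : u c ≠ 0) (hx : 2 ≤ u x) :
    (monomial u (1 : F) : MvPolynomial (Fin m × Fin n) F) ∈ subpermIdeal F m n 2 := by
  have hx0 : u x ≠ 0 := by omega
  have hab : a ≠ b := fun e => hab1 (congrArg Prod.fst e)
  have hac : a ≠ c := fun e => hac1 (congrArg Prod.fst e)
  have hbc : b ≠ c := fun e => hbc1 (congrArg Prod.fst e)
  -- the Lemma 2.2 pattern `x_p x_q x_x²` for distinct rows and columns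
  have key : ∀ p q : Fin m × Fin n, p.1 ≠ x.1 → q.1 ≠ x.1 → p.2 ≠ q.2 → p.2 ≠ x.2 → q.2 ≠ x.2 →
      p ≠ q → u p ≠ 0 → u q ≠ 0 →
      (monomial u (1 : F) : MvPolynomial (Fin m × Fin n) F) ∈ subpermIdeal F m n 2 := by
    intro p q hp1 hq1 hpq2 hp2 hq2 hpq hup huq
    have hmem := lemma_2_2_sq h2 hp1 hq1 hpq2 hp2 hq2 (F := F)
    have e : (X (p.1, p.2) * X (q.1, q.2) * X (x.1, x.2) ^ 2 : MvPolynomial (Fin m × Fin n) F) =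
        monomial (Finsupp.single p 1 + Finsupp.single q 1 + (Finsupp.single x 1 +
          Finsupp.single x 1)) 1 := by
      simp only [Prod.mk.eta, X, monomial_mul, pow_two, mul_one]
    rw [e] at hmem
    exact monomial_mem_of_le (single_add_single_add_two_le hpq (fun h => hp2 (congrArg Prod.snd h))
      (fun h => hq2 (congrArg Prod.snd h)) u hup huq hx) hmem
  by_cases hxa : x = a
  · subst hxa
    exact key b c hab1.symm hac1.symm hbc2 hab2.symm hac2.symm hbc hb hc
  by_cases hxb : x = b
  · subst hxb
    exact key a c hab1 hbc1.symm hac2 hab2 hbc2.symm hac ha hc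
  by_cases hxc : x = c
  · subst hxc
    exact key a b hac1 hbc1 hab2 hac2 hbc2 hab ha hb
  -- `x` is a fourth point: shares a row, a column, or nothing with the triple
  by_cases h1 : x.1 = a.1
  · exact monomial_mem_of_rowShare h2 hab1 hac1 hbc2 hab2 hac2 ha hb hc hx0 h1 hxa
  by_cases h2' : x.1 = b.1
  · exact monomial_mem_of_rowShare h2 hab1.symm hbc1 hac2 hab2.symm hbc2 hb ha hc hx0 h2' hxb
  by_cases h3 : x.1 = c.1
  · exact monomial_mem_of_rowShare h2 hac1.symm hbc1.symm hab2 hac2.symm hbc2.symm hc ha hb hx0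
      h3 hxc
  by_cases h4 : x.2 = a.2
  · exact monomial_mem_of_colShare h2 hab2 hac2 hbc1 hab1 hac1 ha hb hc hx0 h4 hxa
  by_cases h5 : x.2 = b.2
  · exact monomial_mem_of_colShare h2 hab2.symm hbc2 hac1 hab1.symm hbc1 hb ha hc hx0 h5 hxb
  by_cases h6 : x.2 = c.2
  · exact monomial_mem_of_colShare h2 hac2.symm hbc2.symm hab1 hac1.symm hbc1.symm hc ha hb hx0
      h6 hxc
  · exact key a b (fun h => h1 h.symm) (fun h => h2' h.symm) hab2 (fun h => h4 h.symm)
      (fun h => h5 h.symm) hab ha hb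

/-- **Two support points in one row**: if `x ≠ y ∈ supp u` share a row and `a, b, c ∈ supp u`
form a permutation triple, then `x^u ∈ P₂(M)`. [cite: LaubenbacherSwanson2000, Lemma 2.1 (arXiv text p0003 L10–35)] -/
private theorem monomial_mem_of_rowPair (h2 : IsUnit (2 : F)) {u : Fin m × Fin n →₀ ℕ}
    {a b c x y : Fin m × Fin n} (hab1 : a.1 ≠ b.1) (hac1 : a.1 ≠ c.1) (hbc1 : b.1 ≠ c.1)
    (hab2 : a.2 ≠ b.2) (hac2 : a.2 ≠ c.2) (hbc2 : b.2 ≠ c.2)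
    (ha : u a ≠ 0) (hb : u b ≠ 0) (hc : u c ≠ 0) (hx : u x ≠ 0) (hy : u y ≠ 0) (hxy : x ≠ y)
    (hrow : x.1 = y.1) :
    (monomial u (1 : F) : MvPolynomial (Fin m × Fin n) F) ∈ subpermIdeal F m n 2 := by
  have hxy2 : x.2 ≠ y.2 := fun h => hxy (Prod.ext hrow h)
  -- `x` or `y` shares a row with the triple
  by_cases h1 : x.1 = a.1
  · by_cases hxa : x = a
    · subst hxa
      exact monomial_mem_of_rowShare h2 hab1 hac1 hbc2 hab2 hac2 hx hb hc hy hrow.symm hxy.symm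
    · exact monomial_mem_of_rowShare h2 hab1 hac1 hbc2 hab2 hac2 ha hb hc hx h1 hxa
  by_cases h2' : x.1 = b.1
  · by_cases hxb : x = b
    · subst hxb
      exact monomial_mem_of_rowShare h2 hab1.symm hbc1 hac2 hab2.symm hbc2 hx ha hc hy hrow.symm
        hxy.symm
    · exact monomial_mem_of_rowShare h2 hab1.symm hbc1 hac2 hab2.symm hbc2 hb ha hc hx h2' hxb
  by_cases h3 : x.1 = c.1
  · by_cases hxc : x = c
    · subst hxc
      exact monomial_mem_of_rowShare h2 hac1.symm hbc1.symm hab2 hac2.symm hbc2.symm hx ha hb hy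
        hrow.symm hxy.symm
    · exact monomial_mem_of_rowShare h2 hac1.symm hbc1.symm hab2 hac2.symm hbc2.symm hc ha hb hx
        h3 hxc
  -- the common row of `x, y` avoids the triple; columns?
  have hxa : x ≠ a := fun e => h1 (congrArg Prod.fst e)
  have hxb : x ≠ b := fun e => h2' (congrArg Prod.fst e)
  have hxc : x ≠ c := fun e => h3 (congrArg Prod.fst e)
  have hya : y ≠ a := fun e => h1 (hrow.trans (congrArg Prod.fst e))
  have hyb : y ≠ b := fun e => h2' (hrow.trans (congrArg Prod.fst e))
  have hyc : y ≠ c := fun e => h3 (hrow.trans (congrArg Prod.fst e))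
  by_cases h4 : x.2 = a.2
  · exact monomial_mem_of_colShare h2 hab2 hac2 hbc1 hab1 hac1 ha hb hc hx h4 hxa
  by_cases h5 : x.2 = b.2
  · exact monomial_mem_of_colShare h2 hab2.symm hbc2 hac1 hab1.symm hbc1 hb ha hc hx h5 hxb
  by_cases h6 : x.2 = c.2
  · exact monomial_mem_of_colShare h2 hac2.symm hbc2.symm hab1 hac1.symm hbc1.symm hc ha hb hx
      h6 hxc
  by_cases h7 : y.2 = a.2
  · exact monomial_mem_of_colShare h2 hab2 hac2 hbc1 hab1 hac1 ha hb hc hy h7 hya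
  by_cases h8 : y.2 = b.2
  · exact monomial_mem_of_colShare h2 hab2.symm hbc2 hac1 hab1.symm hbc1 hb ha hc hy h8 hyb
  by_cases h9 : y.2 = c.2
  · exact monomial_mem_of_colShare h2 hac2.symm hbc2.symm hab1 hac1.symm hbc1.symm hc ha hb hy
      h9 hyc
  -- `x, y` in one row, with columns off the column of `a`: Lemma 2.1 on `x, y, a`
  obtain ⟨x1, x2⟩ := x
  obtain ⟨y1, y2⟩ := y
  obtain ⟨i, p⟩ := a
  simp only at hrow hxy2 h1 h4 h7
  subst hrow
  have hmem := lemma_2_1_rows h2 h1 hxy2 h4 h7 (F := F)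
  exact monomial_mem_of_triple_mem (a := (x1, x2)) (b := (x1, y2)) (c := (i, p))
    (fun h => hxy2 (Prod.mk.inj h).2) (fun h => h1 (Prod.mk.inj h).1) (fun h => h1 (Prod.mk.inj h).1)
    hx hy ha hmem

/-- **Two support points in one column**: the transposed statement. [cite: LaubenbacherSwanson2000, Lemma 2.1 (arXiv text p0003 L10–35)] -/
private theorem monomial_mem_of_colPair (h2 : IsUnit (2 : F)) {u : Fin m × Fin n →₀ ℕ}
    {a b c x y : Fin m × Fin n} (hab1 : a.1 ≠ b.1) (hac1 : a.1 ≠ c.1) (hbc1 : b.1 ≠ c.1)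
    (hab2 : a.2 ≠ b.2) (hac2 : a.2 ≠ c.2) (hbc2 : b.2 ≠ c.2)
    (ha : u a ≠ 0) (hb : u b ≠ 0) (hc : u c ≠ 0) (hx : u x ≠ 0) (hy : u y ≠ 0) (hxy : x ≠ y)
    (hcol : x.2 = y.2) :
    (monomial u (1 : F) : MvPolynomial (Fin m × Fin n) F) ∈ subpermIdeal F m n 2 := by
  have hxy1 : x.1 ≠ y.1 := fun h => hxy (Prod.ext h hcol)
  by_cases h1 : x.2 = a.2
  · by_cases hxa : x = a
    · subst hxa
      exact monomial_mem_of_colShare h2 hab2 hac2 hbc1 hab1 hac1 hx hb hc hy hcol.symm hxy.symm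
    · exact monomial_mem_of_colShare h2 hab2 hac2 hbc1 hab1 hac1 ha hb hc hx h1 hxa
  by_cases h2' : x.2 = b.2
  · by_cases hxb : x = b
    · subst hxb
      exact monomial_mem_of_colShare h2 hab2.symm hbc2 hac1 hab1.symm hbc1 hx ha hc hy hcol.symm
        hxy.symm
    · exact monomial_mem_of_colShare h2 hab2.symm hbc2 hac1 hab1.symm hbc1 hb ha hc hx h2' hxb
  by_cases h3 : x.2 = c.2
  · by_cases hxc : x = c
    · subst hxc
      exact monomial_mem_of_colShare h2 hac2.symm hbc2.symm hab1 hac1.symm hbc1.symm hx ha hb hy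
        hcol.symm hxy.symm
    · exact monomial_mem_of_colShare h2 hac2.symm hbc2.symm hab1 hac1.symm hbc1.symm hc ha hb hx
        h3 hxc
  have hxa : x ≠ a := fun e => h1 (congrArg Prod.snd e)
  have hxb : x ≠ b := fun e => h2' (congrArg Prod.snd e)
  have hxc : x ≠ c := fun e => h3 (congrArg Prod.snd e)
  have hya : y ≠ a := fun e => h1 (hcol.trans (congrArg Prod.snd e))
  have hyb : y ≠ b := fun e => h2' (hcol.trans (congrArg Prod.snd e))
  have hyc : y ≠ c := fun e => h3 (hcol.trans (congrArg Prod.snd e))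
  by_cases h4 : x.1 = a.1
  · exact monomial_mem_of_rowShare h2 hab1 hac1 hbc2 hab2 hac2 ha hb hc hx h4 hxa
  by_cases h5 : x.1 = b.1
  · exact monomial_mem_of_rowShare h2 hab1.symm hbc1 hac2 hab2.symm hbc2 hb ha hc hx h5 hxb
  by_cases h6 : x.1 = c.1
  · exact monomial_mem_of_rowShare h2 hac1.symm hbc1.symm hab2 hac2.symm hbc2.symm hc ha hb hx
      h6 hxc
  by_cases h7 : y.1 = a.1
  · exact monomial_mem_of_rowShare h2 hab1 hac1 hbc2 hab2 hac2 ha hb hc hy h7 hya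
  by_cases h8 : y.1 = b.1
  · exact monomial_mem_of_rowShare h2 hab1.symm hbc1 hac2 hab2.symm hbc2 hb ha hc hy h8 hyb
  by_cases h9 : y.1 = c.1
  · exact monomial_mem_of_rowShare h2 hac1.symm hbc1.symm hab2 hac2.symm hbc2.symm hc ha hb hy
      h9 hyc
  obtain ⟨x1, x2⟩ := x
  obtain ⟨y1, y2⟩ := y
  obtain ⟨i, p⟩ := a
  simp only at hcol hxy1 h1 h4 h7
  subst hcol
  have hmem := lemma_2_1_cols h2 hxy1 h4 h7 h1 (F := F)
  exact monomial_mem_of_triple_mem (a := (x1, x2)) (b := (y1, x2)) (c := (i, p))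
    (fun h => hxy1 (Prod.mk.inj h).1) (fun h => h4 (Prod.mk.inj h).1) (fun h => h7 (Prod.mk.inj h).1)
    hx hy ha hmem

/-- **Multiples of a permutation triple that are not partial-permutation monomials lie in
`P₂(M)`**: if `a, b, c ∈ supp u` have pairwise distinct rows and columns and some row or column
content of `u` is `≥ 2`, then `x^u ∈ P₂(M)` (`2` a unit; Lemmas 2.1–2.2) — the substance of LS's
"least common multiples of these two types of monomials are all in the ideal generated by
monomials of types (2)–(6) in the Gröbner basis of `P₂(M)`" (p0008 L84–89), proof deviation.
[cite: LaubenbacherSwanson2000, proof of Thm. 5.7 (arXiv text p0008 L71–91)] -/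
theorem monomial_mem_of_triple_of_two_le_weight (h2 : IsUnit (2 : F)) {u : Fin m × Fin n →₀ ℕ}
    {a b c : Fin m × Fin n} (hab1 : a.1 ≠ b.1) (hac1 : a.1 ≠ c.1) (hbc1 : b.1 ≠ c.1)
    (hab2 : a.2 ≠ b.2) (hac2 : a.2 ≠ c.2) (hbc2 : b.2 ≠ c.2)
    (ha : u a ≠ 0) (hb : u b ≠ 0) (hc : u c ≠ 0)
    (hu : (∃ i, 2 ≤ (Finsupp.weight
        (fun x : Fin m × Fin n => (Finsupp.single x.1 (1 : ℕ), Finsupp.single x.2 (1 : ℕ))) u).1 i) ∨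
      (∃ j, 2 ≤ (Finsupp.weight
        (fun x : Fin m × Fin n => (Finsupp.single x.1 (1 : ℕ), Finsupp.single x.2 (1 : ℕ))) u).2 j)) :
    (monomial u (1 : F) : MvPolynomial (Fin m × Fin n) F) ∈ subpermIdeal F m n 2 := by
  classical
  rcases hu with ⟨i, hi⟩ | ⟨j, hj⟩
  · rw [weight_fst_apply] at hi
    rcases exists_of_two_le_sum hi with ⟨x, -, hx⟩ | ⟨x, hxS, y, hyS, hxy, hx, hy⟩
    · exact monomial_mem_of_sq h2 hab1 hac1 hbc1 hab2 hac2 hbc2 ha hb hc hx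
    · have hrow : x.1 = y.1 := (Finset.mem_filter.1 hxS).2.trans (Finset.mem_filter.1 hyS).2.symm
      exact monomial_mem_of_rowPair h2 hab1 hac1 hbc1 hab2 hac2 hbc2 ha hb hc hx hy hxy hrow
  · rw [weight_snd_apply] at hj
    rcases exists_of_two_le_sum hj with ⟨x, -, hx⟩ | ⟨x, hxS, y, hyS, hxy, hx, hy⟩
    · exact monomial_mem_of_sq h2 hab1 hac1 hbc1 hab2 hac2 hbc2 ha hb hc hx
    · have hcol : x.2 = y.2 := (Finset.mem_filter.1 hxS).2.trans (Finset.mem_filter.1 hyS).2.symm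
      exact monomial_mem_of_colPair h2 hab1 hac1 hbc1 hab2 hac2 hbc2 ha hb hc hx hy hxy hcol

/-! ### §C. `⟨x_{ij}²⟩ ∩ (P₂(M) + ⟨x_{ip} x_{jq} x_{kr}⟩) ⊆ P₂(M)` and Theorem 5.7 -/

/-- The components of an element of `⟨x_{ip} x_{jq} x_{kr} | i,j,k distinct, p,q,r distinct⟩` in a
row/column content that is NOT a partial permutation lie in `P₂(M)`.
[cite: LaubenbacherSwanson2000, proof of Thm. 5.7 (arXiv text p0008 L71–91)] -/
theorem weightedHomogeneousComponent_mem_of_mem_span_triple (h2 : IsUnit (2 : F))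
    {t : MvPolynomial (Fin m × Fin n) F}
    (ht : t ∈ Ideal.span {f : MvPolynomial (Fin m × Fin n) F | ∃ a b c : Fin m × Fin n,
        (a.1 ≠ b.1 ∧ a.1 ≠ c.1 ∧ b.1 ≠ c.1) ∧ (a.2 ≠ b.2 ∧ a.2 ≠ c.2 ∧ b.2 ≠ c.2) ∧
          f = X a * X b * X c})
    (δ : (Fin m →₀ ℕ) × (Fin n →₀ ℕ)) (hδ : (∃ i, 2 ≤ δ.1 i) ∨ (∃ j, 2 ≤ δ.2 j)) :
    weightedHomogeneousComponent
        (fun x : Fin m × Fin n => (Finsupp.single x.1 (1 : ℕ), Finsupp.single x.2 (1 : ℕ))) δ t ∈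
      subpermIdeal F m n 2 := by
  classical
  suffices H : ∀ f ∈ Ideal.span {f : MvPolynomial (Fin m × Fin n) F | ∃ a b c : Fin m × Fin n,
        (a.1 ≠ b.1 ∧ a.1 ≠ c.1 ∧ b.1 ≠ c.1) ∧ (a.2 ≠ b.2 ∧ a.2 ≠ c.2 ∧ b.2 ≠ c.2) ∧
          f = X a * X b * X c}, ∀ g : MvPolynomial (Fin m × Fin n) F,
      weightedHomogeneousComponent
        (fun x : Fin m × Fin n => (Finsupp.single x.1 (1 : ℕ), Finsupp.single x.2 (1 : ℕ))) δ
          (g * f) ∈ subpermIdeal F m n 2 by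
    simpa only [one_mul] using H t ht 1
  intro f hf
  refine Submodule.span_induction ?_ ?_ ?_ ?_ hf
  · rintro f ⟨a, b, c, ⟨hab1, hac1, hbc1⟩, ⟨hab2, hac2, hbc2⟩, rfl⟩ g
    induction g using MvPolynomial.induction_on' with
    | monomial u k =>
      have e : (monomial u k * (X a * X b * X c) : MvPolynomial (Fin m × Fin n) F) =
          monomial (u + (Finsupp.single a 1 + Finsupp.single b 1 + Finsupp.single c 1)) k := by
        simp only [X, monomial_mul, mul_one]
      rw [e, whc_monomial]
      split_ifs with hw
      · -- the monomial has row/column content `δ`, not a partial permutation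
        have hab : a ≠ b := fun e => hab1 (congrArg Prod.fst e)
        have hac : a ≠ c := fun e => hac1 (congrArg Prod.fst e)
        have hbc : b ≠ c := fun e => hbc1 (congrArg Prod.fst e)
        have hva : ((u + (Finsupp.single a 1 + Finsupp.single b 1 + Finsupp.single c 1) :
            Fin m × Fin n →₀ ℕ) a) ≠ 0 := by
          rw [Finsupp.add_apply, Finsupp.add_apply, Finsupp.add_apply, Finsupp.single_eq_same,
            Finsupp.single_eq_of_ne hab, Finsupp.single_eq_of_ne hac]
          omega
        have hvb : ((u + (Finsupp.single a 1 + Finsupp.single b 1 + Finsupp.single c 1) :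
            Fin m × Fin n →₀ ℕ) b) ≠ 0 := by
          rw [Finsupp.add_apply, Finsupp.add_apply, Finsupp.add_apply, Finsupp.single_eq_same,
            Finsupp.single_eq_of_ne hab.symm, Finsupp.single_eq_of_ne hbc]
          omega
        have hvc : ((u + (Finsupp.single a 1 + Finsupp.single b 1 + Finsupp.single c 1) :
            Fin m × Fin n →₀ ℕ) c) ≠ 0 := by
          rw [Finsupp.add_apply, Finsupp.add_apply, Finsupp.add_apply, Finsupp.single_eq_same,
            Finsupp.single_eq_of_ne hac.symm, Finsupp.single_eq_of_ne hbc.symm]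
          omega
        have hmem := monomial_mem_of_triple_of_two_le_weight h2 hab1 hac1 hbc1 hab2 hac2 hbc2
          hva hvb hvc (hw ▸ hδ)
        rw [← mul_one k, ← C_mul_monomial]
        exact Ideal.mul_mem_left _ _ hmem
      · exact Ideal.zero_mem _
    | add p q hp hq =>
      rw [add_mul, map_add]
      exact Ideal.add_mem _ hp hq
  · intro g
    simp
  · intro x y _ _ hx hy g
    rw [mul_add, map_add]
    exact Ideal.add_mem _ (hx g) (hy g)
  · intro r x _ hx g
    rw [smul_eq_mul, ← mul_assoc]
    exact hx (g * r)

/-- **`⟨x_{ij}²⟩` has no partial-permutation components**: for `f` in the ideal of the squares of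
the variables, every weighted homogeneous component in a row/column content with all entries
`≤ 1` vanishes (every monomial of `f` contains a square). [cite: LaubenbacherSwanson2000, proof of Thm. 5.7 (arXiv text p0008 L84–85)] -/
theorem weightedHomogeneousComponent_eq_zero_of_mem_span_sq {f : MvPolynomial (Fin m × Fin n) F}
    (hf : f ∈ Ideal.span (Set.range fun a : Fin m × Fin n =>
      (X a ^ 2 : MvPolynomial (Fin m × Fin n) F)))
    (δ : (Fin m →₀ ℕ) × (Fin n →₀ ℕ)) (hδ : (∀ i, δ.1 i ≤ 1) ∧ (∀ j, δ.2 j ≤ 1)) :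
    weightedHomogeneousComponent
        (fun x : Fin m × Fin n => (Finsupp.single x.1 (1 : ℕ), Finsupp.single x.2 (1 : ℕ))) δ f =
      0 := by
  classical
  have hset : (Set.range fun a : Fin m × Fin n => (X a ^ 2 : MvPolynomial (Fin m × Fin n) F)) =
      (fun s => monomial s (1 : F)) '' Set.range (fun a : Fin m × Fin n => Finsupp.single a 2) := by
    ext g
    constructor
    · rintro ⟨a, rfl⟩
      exact ⟨_, ⟨a, rfl⟩, by simp [X_pow_eq_monomial]⟩
    · rintro ⟨s, ⟨a, rfl⟩, rfl⟩
      exact ⟨a, by simp [X_pow_eq_monomial]⟩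
  rw [hset, mem_ideal_span_monomial_image] at hf
  ext u
  rw [coeff_weightedHomogeneousComponent, coeff_zero]
  split_ifs with hw
  · by_contra hne
    obtain ⟨s, ⟨a, rfl⟩, hle⟩ := hf u (mem_support_iff.2 hne)
    have hua : 2 ≤ u a := by
      have := hle a
      rwa [Finsupp.single_eq_same] at this
    have h1 : 2 ≤ (Finsupp.weight
        (fun x : Fin m × Fin n => (Finsupp.single x.1 (1 : ℕ), Finsupp.single x.2 (1 : ℕ))) u).1
          a.1 := by
      rw [weight_fst_apply]
      exact le_trans hua (Finset.single_le_sum (f := fun x => u x) (fun x _ => Nat.zero_le _)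
        (Finset.mem_filter.2 ⟨Finsupp.mem_support_iff.2 (by omega), rfl⟩))
    rw [hw] at h1
    have := hδ.1 a.1
    omega
  · rfl

/-- **`⟨x_{ij}²⟩ ∩ (P₂(M) + ⟨x_{ip} x_{jq} x_{kr}⟩) ⊆ P₂(M)`** (LS p0008 L62–76: "To simplify the last
intersection and prove that it lies in `P₂(M)`, we use Gröbner bases again …"), `2` a unit, any
`m, n`.  PROOF DEVIATION (statement as printed): decompose `f = p + t` into its row/column-content
components; the partial-permutation components of `f` vanish (`f ∈ ⟨x_{ij}²⟩`), the others of `p`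
and of `t` lie in `P₂(M)`. [cite: LaubenbacherSwanson2000, proof of Thm. 5.7 (arXiv text p0008 L54–91)] -/
theorem span_sq_inf_sup_span_triple_le (h2 : IsUnit (2 : F)) :
    Ideal.span (Set.range fun a : Fin m × Fin n => (X a ^ 2 : MvPolynomial (Fin m × Fin n) F)) ⊓
        (subpermIdeal F m n 2 ⊔
          Ideal.span {f : MvPolynomial (Fin m × Fin n) F | ∃ a b c : Fin m × Fin n,
            (a.1 ≠ b.1 ∧ a.1 ≠ c.1 ∧ b.1 ≠ c.1) ∧ (a.2 ≠ b.2 ∧ a.2 ≠ c.2 ∧ b.2 ≠ c.2) ∧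
              f = X a * X b * X c}) ≤
      subpermIdeal F m n 2 := by
  classical
  rintro f ⟨hfS, hfPT⟩
  obtain ⟨p, hp, t, ht, rfl⟩ := Submodule.mem_sup.1 hfPT
  rw [← sum_weightedHomogeneousComponent
    (fun x : Fin m × Fin n => (Finsupp.single x.1 (1 : ℕ), Finsupp.single x.2 (1 : ℕ))) (p + t),
    finsum_eq_sum _ (weightedHomogeneousComponent_finsupp _)]
  refine Ideal.sum_mem _ fun δ _ => ?_
  by_cases hδ : (∀ i, δ.1 i ≤ 1) ∧ (∀ j, δ.2 j ≤ 1)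
  · rw [weightedHomogeneousComponent_eq_zero_of_mem_span_sq hfS δ hδ]
    exact Ideal.zero_mem _
  · have hδ' : (∃ i, 2 ≤ δ.1 i) ∨ (∃ j, 2 ≤ δ.2 j) := by
      by_contra h
      apply hδ
      constructor
      · intro i
        by_contra hi
        exact h (Or.inl ⟨i, by omega⟩)
      · intro j
        by_contra hj
        exact h (Or.inr ⟨j, by omega⟩)
    rw [map_add]
    exact Ideal.add_mem _ (weightedHomogeneousComponent_mem_subpermIdeal hp δ)
      (weightedHomogeneousComponent_mem_of_mem_span_triple h2 ht δ hδ')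

end Theorem57

section Theorem57Field

variable (F : Type*) [Field F] {m n : ℕ}

/-- **Theorem 5.7, the identity `P₂(M) = Q ∩ rad P₂(M)`** with `Q = P₂(M) + ⟨x_{ij}² | all i, j⟩`
(LS p0008 L54–64: "`Q ∩ I₁ ∩ I₂ ∩ I₃ = (P₂ + ⟨x_{ij}²⟩) ∩ (P₂ + Σ⟨x_{ij}x_{kl}x_{pq}⟩) =
P₂ + ⟨x_{ij}²⟩ ∩ (P₂ + Σ⟨x_{ij}x_{kl}x_{pq}⟩)`" and "… prove that it lies in `P₂(M)`"), over a field
with `2 ≠ 0`, typed for all `m, n ≥ 2` ⊇ printed `m, n ≥ 3` (for `m = 2` or `n = 2` the radical is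
`P₂(M)` itself). [cite: LaubenbacherSwanson2000, Thm. 5.7 (arXiv text p0008 L48–108)] -/
theorem thm_5_7_radical (h2 : (2 : F) ≠ 0) (hm : 2 ≤ m) (hn : 2 ≤ n) :
    subpermIdeal F m n 2 =
      (subpermIdeal F m n 2 ⊔ Ideal.span (Set.range fun a : Fin m × Fin n =>
        (X a ^ 2 : MvPolynomial (Fin m × Fin n) F))) ⊓ (subpermIdeal F m n 2).radical := by
  apply le_antisymm
  · exact le_inf le_sup_left Ideal.le_radical
  · rw [thm_5_4 F h2 hm hn, sup_inf_assoc_of_le _ (le_sup_left : subpermIdeal F m n 2 ≤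
      subpermIdeal F m n 2 ⊔ Ideal.span {f : MvPolynomial (Fin m × Fin n) F |
        ∃ a b c : Fin m × Fin n, (a.1 ≠ b.1 ∧ a.1 ≠ c.1 ∧ b.1 ≠ c.1) ∧
          (a.2 ≠ b.2 ∧ a.2 ≠ c.2 ∧ b.2 ≠ c.2) ∧ f = X a * X b * X c})]
    exact sup_le le_rfl (span_sq_inf_sup_span_triple_le h2.isUnit)

/-- **Laubenbacher–Swanson 2000, Theorem 5.7** ("Let `m, n ≥ 3`.  The intersection
`P₂(M) = Q ∩ I₁ ∩ I₂ ∩ I₃`, after rewriting each `I_i` as the intersection of the minimal primes of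
type (i), is an irredundant primary decomposition of `P₂(M)`", with `Q = P₂(M) + ⟨x_{ij}² | 1 ≤ i ≤ m,
1 ≤ j ≤ n⟩`, p0008 L48–52): the displayed IDENTITY, over a field with `2 ≠ 0`, `m, n ≥ 3`, with
`I₁, I₂, I₃` the infima of the type (1), (2), (3) ideals of Thm. 4.1 (`radical_eq_inf`: their
intersection is `rad P₂(M)`).  Together with `isPrimary_sup_span_sq` ("`Q` is primary to the
homogeneous maximal ideal", p0008 L93) and the primality of the type ideals this is a primary
decomposition of `P₂(M)` with the embedded component `Q` made explicit.  NOT typed: the word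
"irredundant" (it needs the associated-prime bookkeeping of the components of heights `(m−1)n`,
`m(n−1)`, `mn−3` and `mn`). [cite: LaubenbacherSwanson2000, Thm. 5.7 (arXiv text p0008 L98–108)] -/
theorem thm_5_7 (h2 : (2 : F) ≠ 0) (hm : 3 ≤ m) (hn : 3 ≤ n) :
    subpermIdeal F m n 2 =
      (subpermIdeal F m n 2 ⊔ Ideal.span (Set.range fun a : Fin m × Fin n =>
        (X a ^ 2 : MvPolynomial (Fin m × Fin n) F))) ⊓
      ((⨅ r : Fin m, Ideal.span ((fun x => (X x : MvPolynomial (Fin m × Fin n) F)) ''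
          {x | x.1 ≠ r})) ⊓
        (⨅ c : Fin n, Ideal.span ((fun x => (X x : MvPolynomial (Fin m × Fin n) F)) ''
          {x | x.2 ≠ c})) ⊓
        ⨅ (r : Fin m) (s : Fin m) (c : Fin n) (d : Fin n) (_ : r ≠ s) (_ : c ≠ d),
          Ideal.span (insert (X (r, c) * X (s, d) + X (r, d) * X (s, c) :
              MvPolynomial (Fin m × Fin n) F)
            ((fun x => (X x : MvPolynomial (Fin m × Fin n) F)) ''
              {x | ¬((x.1 = r ∨ x.1 = s) ∧ (x.2 = c ∨ x.2 = d))}))) := by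
  rw [← radical_eq_inf F h2 (by omega) (by omega)]
  exact thm_5_7_radical F h2 (by omega) (by omega)

/-- The ideal of all the variables `MvPolynomial.idealOfVars` is the kernel of the constant
coefficient, a maximal ideal over a field (private copy of a folklore lemma also proved, e.g., as
`isMaximal_idealOfVars` in `Literature/AlgebraicGeometry/Hironaka2017/Lib/CuspChartRing.lean`, not
imported here). [folklore] -/
private theorem isMaximal_idealOfVars' {σ : Type*} : (MvPolynomial.idealOfVars σ F).IsMaximal := by
  classical
  have hker : RingHom.ker (constantCoeff : MvPolynomial σ F →+* F) = MvPolynomial.idealOfVars σ F := by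
    apply le_antisymm
    · intro f hf
      rw [RingHom.mem_ker] at hf
      rw [MvPolynomial.idealOfVars, ← Set.image_univ, mem_ideal_span_X_image]
      intro u hu
      by_contra h
      have hu0 : u = 0 := by
        ext i
        by_contra hi
        exact h ⟨i, Set.mem_univ i, hi⟩
      rw [hu0, mem_support_iff] at hu
      exact hu hf
    · rw [Ideal.span_le]
      rintro g ⟨i, rfl⟩
      rw [SetLike.mem_coe, RingHom.mem_ker, constantCoeff_X]
  rw [← hker]
  exact RingHom.ker_isMaximal_of_surjective constantCoeff fun r => ⟨C r, constantCoeff_C _ r⟩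

/-- **The radical of `Q = P₂(M) + ⟨x_{ij}²⟩` is the maximal ideal of all the variables**
(Mathlib's `MvPolynomial.idealOfVars = Ideal.span (Set.range X)`; "the homogeneous maximal ideal of
all variables", LS p0008 L93). [cite: LaubenbacherSwanson2000, proof of Thm. 5.7 (arXiv text p0008 L93–96)] -/
theorem radical_sup_span_sq :
    (subpermIdeal F m n 2 ⊔ Ideal.span (Set.range fun a : Fin m × Fin n =>
        (X a ^ 2 : MvPolynomial (Fin m × Fin n) F))).radical =
      MvPolynomial.idealOfVars (Fin m × Fin n) F := by
  apply le_antisymm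
  · refine (Ideal.IsPrime.radical_le_iff (isMaximal_idealOfVars' F).isPrime).2 (sup_le ?_ ?_)
    · refine subpermIdeal_two_le_of_pairs' _ fun r s i j _ _ => ?_
      exact Ideal.add_mem _ (Ideal.mul_mem_left _ _ (Ideal.subset_span ⟨(s, j), rfl⟩))
        (Ideal.mul_mem_left _ _ (Ideal.subset_span ⟨(s, i), rfl⟩))
    · rw [Ideal.span_le]
      rintro g ⟨a, rfl⟩
      change (X a ^ 2 : MvPolynomial (Fin m × Fin n) F) ∈ _
      rw [pow_two]
      exact Ideal.mul_mem_left _ _ (Ideal.subset_span ⟨a, rfl⟩)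
  · rw [MvPolynomial.idealOfVars, Ideal.span_le]
    rintro g ⟨a, rfl⟩
    exact ⟨2, Ideal.mem_sup_right (Ideal.subset_span ⟨a, rfl⟩)⟩

/-- The maximal ideal of all the variables is maximal (re-export for the statement below, over the
field `F`). [cite: LaubenbacherSwanson2000, proof of Thm. 5.7 (arXiv text p0008 L93–96)] -/
theorem isMaximal_radical_sup_span_sq :
    (subpermIdeal F m n 2 ⊔ Ideal.span (Set.range fun a : Fin m × Fin n =>
        (X a ^ 2 : MvPolynomial (Fin m × Fin n) F))).radical.IsMaximal := by
  rw [radical_sup_span_sq]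
  exact isMaximal_idealOfVars' F

/-- **`Q = P₂(M) + ⟨x_{ij}²⟩` is primary** (to the maximal ideal of all the variables; LS p0008
L93: "Since `Q` is primary to the homogeneous maximal ideal of all variables …"), over a field,
any `m, n`. [cite: LaubenbacherSwanson2000, proof of Thm. 5.7 (arXiv text p0008 L93–96)] -/
theorem isPrimary_sup_span_sq :
    (subpermIdeal F m n 2 ⊔ Ideal.span (Set.range fun a : Fin m × Fin n =>
        (X a ^ 2 : MvPolynomial (Fin m × Fin n) F))).IsPrimary :=
  Ideal.isPrimary_of_isMaximal_radical (isMaximal_radical_sup_span_sq F)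

end Theorem57Field

end LaubenbacherSwanson2000

end Literature.Computability.AlgebraicComplexity
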